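import Literature.Probability.LatticeModels.FKFamilyObservable
import Literature.Probability.LatticeModels.FKFreeArcPhase
import Literature.Probability.LatticeModels.FKFreeArcPassage
import HarnessLib

/-!
# Lemma 12 for the observable of a family: `P_C(x ↔ wired arc)² = H_B - Hw_C(x) ≥ H_B - Hb_C(f)`

Topic `Literature/Probability/LatticeModels`; third instalment of the slit-domain observable theory
for the named fact `fkIsing_rsw` (after `FKFamilyObservable.lean`, `FKFamilyPrimitive.lean`). For a
family `C` of configurations (later: a prefix cylinder of the exploration, i.e. the conditional law
given `γ[0,n]`), Duminil-Copin–Hongler–Nolin's Lemma 12 / Duminil-Copin's Proposition 10.2 (lower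
half) for the **conditional** connection probability of a free-arc point:

* `famProb C S` — the `C`-weighted probability of the event `S` (normalised critical FK weights of
  the members whose lift lies in `S`); `famProb_nonneg`, `famProb_le_one`, `famProb_mono`;
* `dartSum_qX_eq` — at the free-arc dart `qX X = ((X,0),3)` of Dobrushin data with start corner
  `c₀ L = ((L,0),3)`, sites of nonnegative height and `(X,-1)` on the free arc, the dart sum of
  every configuration is the indicator of the passage of the interface through `cSrc (qX X)` (one
  visit at most, phase `e^{-iπ W/4} = 1` by `FreeArcPhase.turnCount_eq_zero_or_eight`);
* **`dartObsOn_qX_eq`, `dartFluxOn_qX_eq`**: `F_C(qX X) = P_C(cSrc (qX X) ∈ γ)`,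
  `|F_C(qX X)|² = P_C(cSrc (qX X) ∈ γ)²`, and with `FKFreeArcPassage` (`P(e ∈ γ) = P(x ↔ A)`,
  pathwise) **`dartFluxOn_qX_eq_famProb_openJoined_sq`**: `|F_C(qX X)|² = P_C(x ↔ wired arc)²`;
* for a family primitive: **`famProb_openJoined_sq_eq`** (`P_C(x ↔ A)² = Hw(b) - Hw(x)`, `b` the
  free-arc site below `x`) and **`sub_hb_le_famProb_openJoined_sq`**: `Hw(b) - Hb(f) ≤ P_C(x ↔ A)²`
  for every inner face `f` at `x` ("`1 - Hw(x) ≥ 1 - Hb(f)`", the lower half of Lemma 12 /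
  Proposition 10.2: `√(HM∘(W_x)) ≤ P(x ↔ wired arc)` once `Hw(b) - Hb` is bounded below by a
  harmonic-measure barrier).

Everything here is proved; no named fact is introduced; nothing assumes `fkIsing_rsw`.

## References

* H. Duminil-Copin, C. Hongler, P. Nolin, Comm. Pure Appl. Math. 64 (2011), §4, Lemma 12 and the
  proof of Lemma 15 — bib key `DuminilCopinHonglerNolin2011`.
* H. Duminil-Copin, *Parafermionic observables and their applications*, Ensaios Mat. 25 (2013),
  Prop. 10.2 and the proof of Lemma 10.7.
* S. Smirnov, Ann. of Math. 172 (2010), Lemma 4.11 — bib key `Smirnov2010`.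
-/

noncomputable section

namespace Literature.Probability.LatticeModels

open Complex Finset

variable {E : DiscreteDobrushin}

/-! ### The weighted probability of a family -/

section Prob

variable [Fintype (meshDomain E.Ω E.δ)]

open scoped Classical in
/-- The **`C`-weighted probability** of the event `S` of completed configurations: the normalised
critical FK weight of the members of `C` whose lift lies in `S` (for a prefix cylinder: the
conditional probability given the prefix, `FKExplorationDomainMarkov`). [cite: Grimmett2006, §1.2] -/
def famProb (E : DiscreteDobrushin) [Fintype (meshDomain E.Ω E.δ)] (C : Finset (Finset (Sym2 (meshDomain E.Ω E.δ))))
    (S : Set (Percolation.BondConfig (Site 2))) : ℝ :=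
  ∑ ω ∈ C, rcWeight E.interfaceGraph criticalFKIsingParam 2 (Subtype.val ⁻¹' E.zdArcA) ω / famZ E C *
    (if liftConfig E.Ω E.δ ω ∈ S then 1 else 0)

variable (C : Finset (Finset (Sym2 (meshDomain E.Ω E.δ))))

open scoped Classical in
/-- `0 ≤ P_C(S)`. [cite: Grimmett2006, §1.2] -/
theorem famProb_nonneg (S : Set (Percolation.BondConfig (Site 2))) : 0 ≤ famProb E C S :=
  Finset.sum_nonneg fun ω _ => mul_nonneg (weight_div_famZ_nonneg C ω) (by split_ifs <;> norm_num)

open scoped Classical in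
/-- `P_C(S) ≤ 1` for a nonempty family. [cite: Grimmett2006, §1.2] -/
theorem famProb_le_one {C : Finset (Finset (Sym2 (meshDomain E.Ω E.δ)))} (hC : C.Nonempty)
    (S : Set (Percolation.BondConfig (Site 2))) : famProb E C S ≤ 1 := by
  unfold famProb
  calc _ ≤ ∑ ω ∈ C, rcWeight E.interfaceGraph criticalFKIsingParam 2 (Subtype.val ⁻¹' E.zdArcA) ω / famZ E C :=
        Finset.sum_le_sum fun ω _ => mul_le_of_le_one_right (weight_div_famZ_nonneg C ω) (by split_ifs <;> norm_num)
    _ = 1 := sum_weight_div_famZ hC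

open scoped Classical in
/-- Monotonicity of `P_C` on `C`-lifts. [cite: Grimmett2006, §1.2] -/
theorem famProb_mono {S T : Set (Percolation.BondConfig (Site 2))} (h : ∀ ω ∈ C, liftConfig E.Ω E.δ ω ∈ S → liftConfig E.Ω E.δ ω ∈ T) :
    famProb E C S ≤ famProb E C T :=
  Finset.sum_le_sum fun ω hω => mul_le_mul_of_nonneg_left
    (by
      by_cases hS : liftConfig E.Ω E.δ ω ∈ S
      · rw [if_pos hS, if_pos (h ω hω hS)]
      · rw [if_neg hS]; split_ifs <;> norm_num)
    (weight_div_famZ_nonneg C ω)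

open scoped Classical in
/-- Events agreeing on the `C`-lifts have the same `P_C`. [cite: Grimmett2006, §1.2] -/
theorem famProb_congr {S T : Set (Percolation.BondConfig (Site 2))} (h : ∀ ω ∈ C, (liftConfig E.Ω E.δ ω ∈ S ↔ liftConfig E.Ω E.δ ω ∈ T)) :
    famProb E C S = famProb E C T :=
  Finset.sum_congr rfl fun ω hω => by rw [show (liftConfig E.Ω E.δ ω ∈ S) = (liftConfig E.Ω E.δ ω ∈ T) from propext (h ω hω)]

end Prob

/-! ### The dart sum at a free-arc dart is the passage indicator -/

section Passage

variable [Fintype (meshDomain E.Ω E.δ)] (hE : E.IsZdAdmissible) {L X : ℤ}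

omit [Fintype (meshDomain E.Ω E.δ)] in
open scoped Classical in
include hE in
/-- **The dart sum of one configuration at a free-arc dart is the passage indicator** (the winding at
a free-arc edge is deterministic, `FreeArcPhase.turnCount_eq_zero_or_eight`; the dart is visited at
most once; a visit before the exit is a passage and conversely). [cite: DuminilCopinHonglerNolin2011, §4, Lemma 12] -/
theorem dartSum_qX_eq (hc₀ : DiscreteDobrushin.startCorner hE = FreeArcPhase.c₀ L) (hLX : L < X)
    (hheight : ∀ v ∈ meshDomain E.Ω E.δ, v ∉ E.zdArcB → 0 ≤ v 1) (hB : (![X, -1] : Site 2) ∈ E.zdArcB)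
    (hinner : E.IsInnerFace (cFace (FreeArcPhase.qX X))) (ω : Finset (Sym2 (meshDomain E.Ω E.δ))) :
    dartSum E hE ω (FreeArcPhase.qX X) =
      if cSrc (FreeArcPhase.qX X) ∈ fkInterface E (liftConfig E.Ω E.δ ω) then 1 else 0 := by
  unfold dartSum
  set ω' := liftConfig E.Ω E.δ ω with hω'
  set β := E.bcBondConfig ω' with hβ
  set N := DiscreteDobrushin.exitTime hE ω' with hN
  have hc : E.IsStartCorner (FreeArcPhase.c₀ L) := hc₀ ▸ DiscreteDobrushin.isStartCorner_startCorner hE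
  rw [hc₀]
  set S := (Finset.range N).filter (fun j => cornerOrbit β (FreeArcPhase.c₀ L) j = FreeArcPhase.qX X) with hS
  have hphase : ∀ j ∈ S, quarterPhase (turnCount β (FreeArcPhase.c₀ L) j) = 1 := by
    intro j hj
    rw [hS, Finset.mem_filter, Finset.mem_range] at hj
    have hjN : j < DiscreteDobrushin.exitTime hE ω' := hj.1
    rcases FreeArcPhase.turnCount_eq_zero_or_eight (FreeArcPhase.hyp_of_domain hE hc₀ hLX hheight hB ω' hjN hj.2) with h | h
    · rw [h, FreeArcPhase.quarterPhase_zero]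
    · rw [h, FreeArcPhase.quarterPhase_eight]
  have hinj : ∀ i ∈ S, ∀ i' ∈ S, i = i' := by
    intro i hi i' hi'
    rw [hS, Finset.mem_filter, Finset.mem_range] at hi hi'
    by_contra hne
    have hinnerk : ∀ k < max i i', E.IsInnerFace (cFace (cornerOrbit β (FreeArcPhase.c₀ L) k)) := by
      intro k hk
      have := DiscreteDobrushin.isInnerFace_of_lt_exitTime hE ω' (k := k) (by
        have := lt_max_iff.1 hk; omega)
      rwa [hc₀] at this
    rcases Nat.lt_or_gt_of_ne hne with hlt | hlt
    · exact cornerOrbit_ne hE hc hlt (fun k hk => hinnerk k (by omega)) (hi.2.trans hi'.2.symm)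
    · exact cornerOrbit_ne hE hc hlt (fun k hk => hinnerk k (by omega)) (hi'.2.trans hi.2.symm)
  have hpass : cSrc (FreeArcPhase.qX X) ∈ fkInterface E ω' → ∃ i, i ∈ S := by
    intro h
    change cSrc (FreeArcPhase.qX X) ∈ medialExploration E ω' at h
    rw [DiscreteDobrushin.medialExploration_eq_explorationList hE, hc₀, explorationList, List.mem_map] at h
    obtain ⟨i, hi, hiq⟩ := h
    rw [List.mem_range] at hi
    have hfst : (cornerOrbit β (FreeArcPhase.c₀ L) i).1 = (FreeArcPhase.qX X).1 := by
      have hmem : (cornerOrbit β (FreeArcPhase.c₀ L) i).1 ∈ cSrc (FreeArcPhase.qX X) := by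
        rw [← hiq, cSrc]; exact Sym2.mem_mk_left _ _
      rw [cSrc, Sym2.mem_iff] at hmem
      rcases hmem with h1 | h1
      · exact h1
      · exfalso
        refine cornerOrbit_fst_not_mem_zdArcB hE hc ω' i ?_
        rw [h1]
        convert hB using 1
        ext k; fin_cases k <;> simp [FreeArcPhase.qX, cornerUnit]
    have horb : cornerOrbit β (FreeArcPhase.c₀ L) i = FreeArcPhase.qX X := eq_of_cSrc_eq_of_fst_eq hiq hfst
    have hiN : i < N := by
      rcases Nat.lt_or_ge i N with h' | h'
      · exact h'
      · exfalso
        have hi' : i = N := by omega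
        have hno := DiscreteDobrushin.not_isInnerFace_exitTime hE ω'
        rw [hc₀, ← hN, ← hi', horb] at hno
        exact hno hinner
    exact ⟨i, by rw [hS, Finset.mem_filter, Finset.mem_range]; exact ⟨hiN, horb⟩⟩
  have hvisit : ∀ i ∈ S, cSrc (FreeArcPhase.qX X) ∈ fkInterface E ω' := by
    intro i hi
    rw [hS, Finset.mem_filter, Finset.mem_range] at hi
    change cSrc (FreeArcPhase.qX X) ∈ medialExploration E ω'
    rw [DiscreteDobrushin.medialExploration_eq_explorationList hE, hc₀, explorationList, List.mem_map]
    exact ⟨i, List.mem_range.2 (by omega), by rw [hi.2]⟩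
  by_cases hmem : cSrc (FreeArcPhase.qX X) ∈ fkInterface E ω'
  · obtain ⟨i, hi⟩ := hpass hmem
    have hSi : S = {i} := Finset.eq_singleton_iff_unique_mem.2 ⟨hi, fun i' hi' => hinj i' hi' i hi⟩
    rw [if_pos hmem, hSi, Finset.sum_singleton, hphase i hi]
  · have hS0 : S = ∅ := by
      rw [Finset.eq_empty_iff_forall_notMem]
      intro i hi
      exact hmem (hvisit i hi)
    rw [if_neg hmem, hS0, Finset.sum_empty]

open scoped Classical in
include hE in
/-- **The family observable at a free-arc dart is the family passage probability**:
`F_C(qX X) = P_C(cSrc (qX X) ∈ γ)`. [cite: DuminilCopinHonglerNolin2011, §4, Lemma 12] -/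
theorem dartObsOn_qX_eq (hc₀ : DiscreteDobrushin.startCorner hE = FreeArcPhase.c₀ L) (hLX : L < X)
    (hheight : ∀ v ∈ meshDomain E.Ω E.δ, v ∉ E.zdArcB → 0 ≤ v 1) (hB : (![X, -1] : Site 2) ∈ E.zdArcB)
    (hinner : E.IsInnerFace (cFace (FreeArcPhase.qX X))) (C : Finset (Finset (Sym2 (meshDomain E.Ω E.δ)))) :
    dartObsOn E hE C (FreeArcPhase.qX X) = ((famProb E C {ω | cSrc (FreeArcPhase.qX X) ∈ fkInterface E ω} : ℝ) : ℂ) := by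
  unfold dartObsOn famProb
  rw [Complex.ofReal_sum]
  refine Finset.sum_congr rfl fun ω _ => ?_
  rw [dartSum_qX_eq hE hc₀ hLX hheight hB hinner ω, Complex.ofReal_mul]
  congr 1
  by_cases hm : cSrc (FreeArcPhase.qX X) ∈ fkInterface E (liftConfig E.Ω E.δ ω)
  · rw [if_pos hm, if_pos (show liftConfig E.Ω E.δ ω ∈ {ω | cSrc (FreeArcPhase.qX X) ∈ fkInterface E ω} from hm)]; simp
  · rw [if_neg hm, if_neg (show liftConfig E.Ω E.δ ω ∉ {ω | cSrc (FreeArcPhase.qX X) ∈ fkInterface E ω} from hm)]; simp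

open scoped Classical in
include hE in
/-- **`|F_C(qX X)|² = P_C(cSrc (qX X) ∈ γ)²`.** [cite: DuminilCopinHonglerNolin2011, §4, Lemma 12] -/
theorem dartFluxOn_qX_eq (hc₀ : DiscreteDobrushin.startCorner hE = FreeArcPhase.c₀ L) (hLX : L < X)
    (hheight : ∀ v ∈ meshDomain E.Ω E.δ, v ∉ E.zdArcB → 0 ≤ v 1) (hB : (![X, -1] : Site 2) ∈ E.zdArcB)
    (hinner : E.IsInnerFace (cFace (FreeArcPhase.qX X))) (C : Finset (Finset (Sym2 (meshDomain E.Ω E.δ)))) :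
    dartFluxOn E hE C (FreeArcPhase.qX X) = (famProb E C {ω | cSrc (FreeArcPhase.qX X) ∈ fkInterface E ω}) ^ 2 := by
  rw [dartFluxOn, dartObsOn_qX_eq hE hc₀ hLX hheight hB hinner C, Complex.norm_real, Real.norm_of_nonneg (famProb_nonneg C _)]

open scoped Classical in
include hE in
/-- **`|F_C(qX X)|² = P_C(x ↔ wired arc)²`** (`x = (X, 0)`): the passage through the free-arc dart is
the connection of `x` to the wired arc (`cSrc_mem_fkInterface_iff_openJoinedToArcA`, for data with
connected wired arc and a `FreeSideAdj`-chain from the start face to the face of the dart).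
[cite: DuminilCopinHonglerNolin2011, §4, Lemma 12] -/
theorem dartFluxOn_qX_eq_famProb_openJoined_sq (hc₀ : DiscreteDobrushin.startCorner hE = FreeArcPhase.c₀ L) (hLX : L < X)
    (hheight : ∀ v ∈ meshDomain E.Ω E.δ, v ∉ E.zdArcB → 0 ≤ v 1) (hB : (![X, -1] : Site 2) ∈ E.zdArcB)
    (hinner : E.IsInnerFace (cFace (FreeArcPhase.qX X)))
    (hA1 : ((discreteDomainGraph E.Ω E.δ).induce E.zdArcA).Preconnected)
    (hx : (![X, 0] : Site 2) ∈ meshDomain E.Ω E.δ)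
    (hchain : Relation.ReflTransGen (FreeSideAdj E) (cFace (DiscreteDobrushin.startCorner hE)) (cFace (FreeArcPhase.qX X)))
    (C : Finset (Finset (Sym2 (meshDomain E.Ω E.δ)))) :
    dartFluxOn E hE C (FreeArcPhase.qX X) = (famProb E C {ω | E.OpenJoinedToArcA ⟨![X, 0], hx⟩ ω}) ^ 2 := by
  rw [dartFluxOn_qX_eq hE hc₀ hLX hheight hB hinner C]
  have hqB : (FreeArcPhase.qX X).1 + cornerUnit (FreeArcPhase.qX X).2 ∈ E.zdArcB := by
    convert hB using 1
    ext k; fin_cases k <;> simp [FreeArcPhase.qX, cornerUnit]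
  rw [famProb_congr C (S := {ω | cSrc (FreeArcPhase.qX X) ∈ fkInterface E ω}) (T := {ω | E.OpenJoinedToArcA ⟨![X, 0], hx⟩ ω})
    (fun ω _ => cSrc_mem_fkInterface_iff_openJoinedToArcA hE hA1 (FreeArcPhase.qX X) hqB hx hinner hchain _)]

end Passage

/-! ### Lemma 12 for a family primitive -/

namespace IsFamilyPrimitive

variable [Fintype (meshDomain E.Ω E.δ)] {hE : E.IsZdAdmissible} {C : Finset (Finset (Sym2 (meshDomain E.Ω E.δ)))}
  {Hw Hb : Site 2 → ℝ}

/-- **`Hw` one step off the free arc, for a family primitive**: `Hw v = Hw (v + e_k) - |F_C(v, k)|²` at a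
site all of whose faces are inner with `v + e_k` on `B`. [cite: Smirnov2010, §3.3 and Lemma 4.11] -/
theorem hw_eq_of_neighbour_mem_zdArcB (h : IsFamilyPrimitive hE C Hw Hb) {v : Site 2}
    (hall : ∀ j, E.IsInnerFace (faceAt v j)) {k : Fin 4} (hb : v + cornerUnit k ∈ E.zdArcB) :
    Hw v = Hw (v + cornerUnit k) - dartFluxOn E hE C (v, k) := by
  have p := h (v, k) (hall k)
  have hf : E.IsInnerFace (faceAt (v + cornerUnit k) (k + 1)) := by rw [faceAt_add_unit_succ]; exact hall k
  have q := h.hb_eq_hw_of_mem_zdArcB hb hf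
  rw [faceAt_add_unit_succ] at q
  simp only [cFace] at p
  linarith

variable {L X : ℤ}

/-- **Lemma 12 for a family: `P_C(x ↔ wired arc)² = Hw(b) - Hw(x)`** at `x = (X, 0)` with `b = (X, -1)`
on the free arc (all faces at `x` inner). [cite: DuminilCopinHonglerNolin2011, §4, Lemma 12] -/
theorem famProb_openJoined_sq_eq (h : IsFamilyPrimitive hE C Hw Hb)
    (hc₀ : DiscreteDobrushin.startCorner hE = FreeArcPhase.c₀ L) (hLX : L < X)
    (hheight : ∀ v ∈ meshDomain E.Ω E.δ, v ∉ E.zdArcB → 0 ≤ v 1) (hB : (![X, -1] : Site 2) ∈ E.zdArcB)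
    (hall : ∀ j, E.IsInnerFace (faceAt ![X, 0] j))
    (hA1 : ((discreteDomainGraph E.Ω E.δ).induce E.zdArcA).Preconnected)
    (hx : (![X, 0] : Site 2) ∈ meshDomain E.Ω E.δ)
    (hchain : Relation.ReflTransGen (FreeSideAdj E) (cFace (DiscreteDobrushin.startCorner hE)) (cFace (FreeArcPhase.qX X))) :
    (famProb E C {ω | E.OpenJoinedToArcA ⟨![X, 0], hx⟩ ω}) ^ 2 = Hw ![X, -1] - Hw ![X, 0] := by
  have hinner : E.IsInnerFace (cFace (FreeArcPhase.qX X)) := hall 3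
  rw [← dartFluxOn_qX_eq_famProb_openJoined_sq hE hc₀ hLX hheight hB hinner hA1 hx hchain C]
  have e3 : (![X, 0] : Site 2) + cornerUnit 3 = ![X, -1] := by funext i; fin_cases i <;> simp [cornerUnit]
  have hb : (![X, 0] : Site 2) + cornerUnit 3 ∈ E.zdArcB := by rw [e3]; exact hB
  have := h.hw_eq_of_neighbour_mem_zdArcB hall hb
  rw [e3] at this
  change Hw ![X, 0] = Hw ![X, -1] - dartFluxOn E hE C (FreeArcPhase.qX X) at this
  linarith

/-- **The lower half of Lemma 12 / Proposition 10.2 for a family**: for every inner face `f` at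
`x = (X, 0)`, `Hw(b) - Hb(f) ≤ P_C(x ↔ wired arc)²` ("`1 - Hw(x) ≥ 1 - Hb(f)`": the primitive
increases from a site to its faces). [cite: DuminilCopinHonglerNolin2011, §4, Lemma 12] -/
theorem sub_hb_le_famProb_openJoined_sq (h : IsFamilyPrimitive hE C Hw Hb)
    (hc₀ : DiscreteDobrushin.startCorner hE = FreeArcPhase.c₀ L) (hLX : L < X)
    (hheight : ∀ v ∈ meshDomain E.Ω E.δ, v ∉ E.zdArcB → 0 ≤ v 1) (hB : (![X, -1] : Site 2) ∈ E.zdArcB)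
    (hall : ∀ j, E.IsInnerFace (faceAt ![X, 0] j))
    (hA1 : ((discreteDomainGraph E.Ω E.δ).induce E.zdArcA).Preconnected)
    (hx : (![X, 0] : Site 2) ∈ meshDomain E.Ω E.δ)
    (hchain : Relation.ReflTransGen (FreeSideAdj E) (cFace (DiscreteDobrushin.startCorner hE)) (cFace (FreeArcPhase.qX X)))
    (k : Fin 4) :
    Hw ![X, -1] - Hb (faceAt ![X, 0] k) ≤ (famProb E C {ω | E.OpenJoinedToArcA ⟨![X, 0], hx⟩ ω}) ^ 2 := by
  rw [h.famProb_openJoined_sq_eq hc₀ hLX hheight hB hall hA1 hx hchain]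
  linarith [h.hw_le_hb (hall k)]

end IsFamilyPrimitive

end Literature.Probability.LatticeModels
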